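import Mathlib
import HarnessLib
import Literature.Dynamics.Homogeneous.HorocycleFlow
import Literature.Dynamics.Homogeneous.HorocycleFlowFrameStrip
import Literature.Dynamics.Homogeneous.HorocycleFlowUnfolding
import Literature.NumberTheory.LFunctions.HorocycleRateHalf
import Literature.NumberTheory.LFunctions.HorocycleZeroMode
import Literature.NumberTheory.LFunctions.CoprimeResidueSums

/-!
# Proof of Flaminio–Forni's Prop. 5.15 for the modular unit tangent bundle

Discharge of the named fact `Literature.Dynamics.Homogeneous.flaminioForni_closedHorocycle_modular`
(`HorocycleFlow.lean`; L. Flaminio, G. Forni, *Invariant distributions and time averages for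
horocycle flows*, Duke Math. J. 119 (2003) 465–526, Prop. 5.15 (p. 44) with Thm 1.7 and pp. 3, 8):
for every smooth, left `SL(2,ℤ)`-invariant, cusp-supported `f : SL(2,ℝ) → ℂ` there is `c` with
`∫₀¹ f(n(x) a(y)) dx - c = O(y^{1/2} log(1/y))` as `y → 0⁺` (closed cuspidal horocycles of length
`T = 1/y` on `SL(2,ℤ)\SL(2,ℝ)` equidistribute with remainder `O(T^{-1/2} log T)`).

The proof is ELEMENTARY (no spectral theory, no Eisenstein series `E(z,s)`, no representation
theory) and is the frame-bundle version of the tree's proof of the surface case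
(`Literature.NumberTheory.LFunctions.zagier_horocycle_rate_half_holds`, assembly
`zagier_horocycle_rate_half_of`):
1. unfolding over `Γ∞\Γ/Γ∞` on the frame bundle (`IsModularFrameTestFunction.frameUnfolding`,
   `HorocycleFlowUnfolding.lean`): `∫₀¹ f(n(x)a(y)) dx = 2y ∑_{c ≤ N} ∑*_{a mod c} Ψ_p(c²y, a/c)`
   with `p` the profile of `f` in frame coordinates and `Ψ_p` the frame arc transform;
2. Fourier analysis of `Ψ_p(w, ·)` (`IsFrameStripFun.frameArcFourierBound`,
   `HorocycleFlowFrameStrip.lean`): `Ψ_p(w,θ) = ∑_k b_k(w) e(kθ)` with the trivial arc-length bound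
   `‖b_k(w)‖ ≤ (M/√w)/|k|³` and zero mode `u b₀(u²) = k₀(u)`, `k₀ ∈ C²`, `k₀ = 0` on `[2,∞)`;
3. the tree's Ramanujan-sum lemma `CoprimeResidueSums.norm_sum_coprime_sub_le`
   (`∑*_a Ψ(w, a/c) = φ(c) b₀(w) + O(8M/√w)`, here `√w = c√y`) and zero-mode lemma
   `HorocycleZeroMode.zeroMode_bound` (`∑_c (φ(c)/c) k₀(lc) = (∑_d μ(d)/d²)(∫₀² k₀)/l + O(1)`);
4. assembly (this file): with `l = √y`, `N = ⌈2/l⌉`, the row errors add up to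
   `2y · (8M/l) ∑_{c ≤ N} 1/c ≤ 16 M l (1 + log N) ≤ 64 M l log(1/y)` (harmonic sum — the source
   of the logarithm; `0 < y < 1/4`), the zero mode gives `2 (∑ μ(d)/d²) ∫₀² k₀ + O(2 C l)`, whence
   `|∫₀¹ f(n(x)a(y)) dx - c| ≤ (64 M + 2 C) y^{1/2} log(1/y)`.
Flaminio–Forni obtain the same precision by representation theory (the logarithm there comes from
the `𝓘_𝓒`-component); Sarnak's spectral proof gives `O(y^{1/2})` (as does the surface file, via a
stationary-phase integration by parts that we do not need here).

## References
* L. Flaminio, G. Forni, Duke Math. J. 119 (2003) 465–526, Prop. 5.15, Thm 1.7, pp. 3, 8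
  [FlaminioForni2003].
* P. Sarnak, Comm. Pure Appl. Math. 34 (1981) 719–739, Thm. 1 [Sarnak1981].
* H. Iwaniec, *Spectral Methods of Automorphic Forms*, 2nd ed. (2002), §2.4, §3.4 [Iwaniec2002].
-/

noncomputable section

open Complex MeasureTheory Set Filter Topology intervalIntegral Asymptotics
open scoped Real ContDiff MatrixGroups ArithmeticFunction.Moebius
open Literature.NumberTheory.LFunctions Literature.NumberTheory.LFunctions.HorocycleStripFourier

namespace Literature.Dynamics.Homogeneous

/-- Harmonic sums: `∑_{c=1}^{N} 1/c ≤ 1 + log N` (Mathlib's `harmonic_le_one_add_log`). [folklore] -/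
theorem sum_Ioc_one_div_le (N : ℕ) : ∑ c ∈ Finset.Ioc 0 N, (1 / (c : ℝ)) ≤ 1 + Real.log N := by
  have h := harmonic_le_one_add_log N
  rw [harmonic_eq_sum_Icc, Rat.cast_sum] at h
  have e : Finset.Ioc 0 N = Finset.Icc 1 N := by
    ext c; simp only [Finset.mem_Ioc, Finset.mem_Icc]; omega
  rw [e]
  refine le_trans (le_of_eq (Finset.sum_congr rfl fun c _ => ?_)) h
  push_cast
  ring

/-- The elementary logarithm bookkeeping: for `0 < y < 1/4`, `l = √y` and `N ≤ 2/l + 1`,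
`1 + log N ≤ 4 log(1/y)` and `1 ≤ log(1/y)`. [folklore] -/
theorem one_add_log_le {y : ℝ} (hy : 0 < y) (hy4 : y < 1 / 4) {N : ℕ} (hN1 : 1 ≤ N)
    (hNle : (N : ℝ) ≤ 2 / Real.sqrt y + 1) :
    1 ≤ Real.log (1 / y) ∧ 1 + Real.log N ≤ 4 * Real.log (1 / y) := by
  have hl : 0 < Real.sqrt y := Real.sqrt_pos.mpr hy
  have hl1 : Real.sqrt y < 1 := by
    rw [← Real.sqrt_one]; exact Real.sqrt_lt_sqrt hy.le (by linarith)
  have hL : Real.log (1 / y) = -Real.log y := by rw [one_div, Real.log_inv]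
  have hlogl : Real.log (Real.sqrt y) = Real.log y / 2 := Real.log_sqrt hy.le
  -- `1 ≤ log(1/y)` since `1/y > 4 > e`
  have h1 : 1 ≤ Real.log (1 / y) := by
    rw [Real.le_log_iff_exp_le (by positivity)]
    have h4 : (4 : ℝ) ≤ 1 / y := by
      rw [le_div_iff₀ hy]; linarith
    linarith [Real.exp_one_lt_three]
  refine ⟨h1, ?_⟩
  have hN0 : (0 : ℝ) < N := by exact_mod_cast hN1
  have hlogN : Real.log N ≤ Real.log (3 / Real.sqrt y) := by
    apply Real.log_le_log hN0
    calc (N : ℝ) ≤ 2 / Real.sqrt y + 1 := hNle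
      _ ≤ 2 / Real.sqrt y + 1 / Real.sqrt y := by
          gcongr; rw [le_div_iff₀ hl]; linarith
      _ = 3 / Real.sqrt y := by ring
  have hlog3 : Real.log 3 ≤ 2 := by
    have := Real.log_le_sub_one_of_pos (show (0:ℝ) < 3 by norm_num); linarith
  rw [Real.log_div (by norm_num) hl.ne', hlogl] at hlogN
  rw [hL] at h1 ⊢
  linarith

/-- **Flaminio–Forni, closed cuspidal horocycles on the modular unit tangent bundle, PROVED**
(Duke Math. J. 119 (2003), Prop. 5.15 with Thm 1.7 and pp. 3, 8: for `Γ = PSL(2,ℤ)` the finite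
family `𝓑⁺_{1/2}` is empty and only the remainder `𝓒^s(t)(f) T^{-1/2} log T` survives): for every
test function `f` on `SL(2,ℤ)\SL(2,ℝ)`, `∫₀¹ f(n(x)a(y)) dx = c + O(y^{1/2} log(1/y))` as `y → 0⁺`.
The proof is elementary and follows the tree's proof of the surface case
(`zagier_horocycle_rate_half_of`): unfolding of `Γ∞\Γ/Γ∞` on the frame bundle
(`IsModularFrameTestFunction.frameUnfolding`), Ramanujan sums
(`CoprimeResidueSums.norm_sum_coprime_sub_le`) fed with the trivial arc-length bound
`‖b_k(c²y)‖ ≤ (M/(c√y))/|k|³` (`IsFrameStripFun.frameArcFourierBound`), whose sum over the rows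
`c ≤ N ≍ y^{-1/2}` is the harmonic sum `≤ 1 + log N` — the logarithm of the remainder — and the
zero-mode lemma `HorocycleZeroMode.zeroMode_bound`; the constant is
`c = 2 (∑_d μ(d)/d²) ∫₀² k₀`. [cite: FlaminioForni2003, Prop. 5.15 (p. 44) with Thm 1.7 and pp. 3, 8] -/
theorem flaminioForni_closedHorocycle_modular_holds : flaminioForni_closedHorocycle_modular := by
  intro f hf
  have hp : IsFrameStripFun (frameProfile f) := hf.isFrameStripFun_frameProfile
  obtain ⟨b, M, hM0, hsum, hsumm, hbd, k₀, hk₀, hk₀R, hk₀b⟩ := hp.frameArcFourierBound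
  obtain ⟨C, hC⟩ := HorocycleZeroMode.zeroMode_bound hk₀ two_pos hk₀R
  set S : ℂ := ∑' d : ℕ, (μ d : ℂ) / (d : ℂ) ^ 2 with hS
  set I₀ : ℂ := ∫ s in (0 : ℝ)..2, k₀ s with hI₀
  refine ⟨2 * S * I₀, ?_⟩
  have hC0 : 0 ≤ C := by
    have h := hC 2 two_pos 1 (by norm_num)
    exact (norm_nonneg _).trans h
  refine IsBigO.of_bound (64 * M + 2 * C) ?_
  filter_upwards [Ioo_mem_nhdsGT (show (0 : ℝ) < 1 / 4 by norm_num)] with y hy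
  obtain ⟨hy0, hy4⟩ := hy
  have hy2 : y < 1 / 2 := by linarith
  have hy1 : y < 1 := by linarith
  obtain ⟨hl, hl1, hsq, hlN, hNle, hN2⟩ := rows_aux hy0 hy1
  set l : ℝ := Real.sqrt y with hl_def
  set N : ℕ := ⌈2 / l⌉₊ with hN_def
  have hN1 : 1 ≤ N := by
    have : (0 : ℝ) < N := by
      have h2l : (0:ℝ) < 2 / l := by positivity
      exact lt_of_lt_of_le h2l (Nat.le_ceil _)
    exact_mod_cast this
  obtain ⟨hL1, hlogN⟩ := one_add_log_le hy0 hy4 hN1 hNle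
  set L : ℝ := Real.log (1 / y) with hL_def
  -- Step 1: unfolding
  rw [hf.frameUnfolding hy0 hy2 hN2]
  -- Step 2: the rows, `∑*_{a mod c} Ψ(c²y, a/c) = φ(c) b₀(c²y) + O(8M/(c l))`
  have hrow : ∀ c ∈ Finset.Ioc 0 N,
      ‖∑ a ∈ (Finset.range c).filter (fun a => Nat.Coprime c a),
          frameArcTransform (frameProfile f) ((c : ℝ) ^ 2 * y) ((a : ℝ) / c) -
        (Nat.totient c : ℂ) * b 0 ((c : ℝ) ^ 2 * y)‖ ≤ 8 * (M / ((c : ℝ) * l)) := by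
    intro c hc
    have hc0 : 0 < c := (Finset.mem_Ioc.mp hc).1
    have hw : 0 < (c : ℝ) ^ 2 * y := by positivity
    have hsqrt : Real.sqrt ((c : ℝ) ^ 2 * y) = c * l := by
      rw [Real.sqrt_mul (sq_nonneg _), Real.sqrt_sq (by positivity)]
    have h := CoprimeResidueSums.norm_sum_coprime_sub_le (hsum _ hw) (hsumm _ hw)
      (fun k hk => hbd _ hw k hk) hc0
    rwa [hsqrt] at h
  have hE₁ : ‖∑ c ∈ Finset.Ioc 0 N, ∑ a ∈ (Finset.range c).filter (fun a => Nat.Coprime c a),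
        frameArcTransform (frameProfile f) ((c : ℝ) ^ 2 * y) ((a : ℝ) / c) -
      ∑ c ∈ Finset.Ioc 0 N, (Nat.totient c : ℂ) * b 0 ((c : ℝ) ^ 2 * y)‖ ≤ 8 * M / l * (1 + Real.log N) := by
    rw [← Finset.sum_sub_distrib]
    calc _ ≤ ∑ c ∈ Finset.Ioc 0 N, ‖∑ a ∈ (Finset.range c).filter (fun a => Nat.Coprime c a),
          frameArcTransform (frameProfile f) ((c : ℝ) ^ 2 * y) ((a : ℝ) / c) -
            (Nat.totient c : ℂ) * b 0 ((c : ℝ) ^ 2 * y)‖ := norm_sum_le _ _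
      _ ≤ ∑ c ∈ Finset.Ioc 0 N, 8 * (M / ((c : ℝ) * l)) := Finset.sum_le_sum hrow
      _ = 8 * M / l * ∑ c ∈ Finset.Ioc 0 N, (1 / (c : ℝ)) := by
          rw [Finset.mul_sum]
          refine Finset.sum_congr rfl fun c hc => ?_
          have hc0 : (0 : ℝ) < c := by exact_mod_cast (Finset.mem_Ioc.mp hc).1
          field_simp
      _ ≤ 8 * M / l * (1 + Real.log N) := by
          gcongr
          exact sum_Ioc_one_div_le N
  -- Step 3: the zero mode, `φ(c) b₀(c²y) = (1/l) (φ(c)/c) k₀(lc)`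
  have hzero : ∑ c ∈ Finset.Ioc 0 N, (Nat.totient c : ℂ) * b 0 ((c : ℝ) ^ 2 * y) =
      (1 / (l : ℂ)) * ∑ c ∈ Finset.Ioc 0 N, ((Nat.totient c : ℂ) / c) * k₀ (l * c) := by
    rw [Finset.mul_sum]
    refine Finset.sum_congr rfl fun c hc => ?_
    have hc0 : 0 < c := (Finset.mem_Ioc.mp hc).1
    have hc0' : (0 : ℝ) < c := by exact_mod_cast hc0
    have hlc : 0 < l * c := mul_pos hl hc0'
    have hk := hk₀b (l * c) hlc
    have e1 : (l * c) ^ 2 = (c : ℝ) ^ 2 * y := by rw [mul_pow, hsq]; ring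
    rw [e1] at hk
    rw [← hk]
    have hl0 : (l : ℂ) ≠ 0 := by exact_mod_cast hl.ne'
    have hc0'' : (c : ℂ) ≠ 0 := by exact_mod_cast hc0.ne'
    push_cast
    field_simp
  have hE₂ := hC l hl N hlN
  -- Step 4: combine
  set T₁ : ℂ := ∑ c ∈ Finset.Ioc 0 N, ∑ a ∈ (Finset.range c).filter (fun a => Nat.Coprime c a),
      frameArcTransform (frameProfile f) ((c : ℝ) ^ 2 * y) ((a : ℝ) / c) with hT₁
  set T₂ : ℂ := ∑ c ∈ Finset.Ioc 0 N, ((Nat.totient c : ℂ) / c) * k₀ (l * c) with hT₂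
  set T₃ : ℂ := ∑ c ∈ Finset.Ioc 0 N, (Nat.totient c : ℂ) * b 0 ((c : ℝ) ^ 2 * y) with hT₃
  have hl0 : (l : ℂ) ≠ 0 := by exact_mod_cast hl.ne'
  have hyl : (y : ℂ) = (l : ℂ) ^ 2 := by rw [← hsq]; push_cast; ring
  have key : 2 * (y : ℂ) * T₁ - 2 * S * I₀ =
      2 * (y : ℂ) * (T₁ - T₃) + 2 * (l : ℂ) * (T₂ - S * I₀ / l) := by
    rw [hzero, hyl]
    field_simp
    ring
  rw [key]
  have hnl : ‖(fun y : ℝ => y ^ (1 / 2 : ℝ) * Real.log (1 / y)) y‖ = l * L := by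
    simp only [hl_def, hL_def]
    rw [norm_mul, Real.norm_of_nonneg (Real.rpow_nonneg hy0.le _), Real.sqrt_eq_rpow,
      Real.norm_of_nonneg (by linarith)]
  rw [hnl]
  have hyle : y ≤ l := by nlinarith
  have hyl' : y / l = l := by rw [div_eq_iff hl.ne', ← hsq]; ring
  have hlogN0 : 0 ≤ 1 + Real.log N := by
    have : (0:ℝ) ≤ Real.log N := Real.log_natCast_nonneg N
    linarith
  calc ‖2 * (y : ℂ) * (T₁ - T₃) + 2 * (l : ℂ) * (T₂ - S * I₀ / l)‖
      ≤ ‖2 * (y : ℂ) * (T₁ - T₃)‖ + ‖2 * (l : ℂ) * (T₂ - S * I₀ / l)‖ := norm_add_le _ _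
    _ ≤ 2 * y * (8 * M / l * (1 + Real.log N)) + 2 * l * C := by
        rw [norm_mul, norm_mul, norm_mul, norm_mul, Complex.norm_real, Complex.norm_real,
          Real.norm_of_nonneg hy0.le, Real.norm_of_nonneg hl.le]
        norm_num
        gcongr
    _ = 16 * M * (y / l) * (1 + Real.log N) + 2 * l * C := by ring
    _ = 16 * M * l * (1 + Real.log N) + 2 * l * C := by rw [hyl']
    _ ≤ 16 * M * l * (4 * L) + 2 * l * C * L := by
        have h1 : 16 * M * l * (1 + Real.log N) ≤ 16 * M * l * (4 * L) :=
          mul_le_mul_of_nonneg_left hlogN (by positivity)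
        have h2 : 2 * l * C ≤ 2 * l * C * L := le_mul_of_one_le_right (by positivity) hL1
        linarith
    _ = (64 * M + 2 * C) * (l * L) := by ring

end Literature.Dynamics.Homogeneous

end
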